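import Summits.CriticalPhenomena.PercolationContinuityZ3.Theorems.Transplant.SkelNegBParamsRootVals
import HarnessLib

/-!
# N1 params, chain of record `NegB`, part RootCases: THE RUN ORIGIN AND START HALF-WIDTH OF THE ROOT RESIDUE PER BRIDGE CASE (NEG-SCOPE B.13) — generic origin
# `KS.yLof σ d₀ d₁ mh := (σ(n_L + d₀), σ(h_L + d₁) + mh)` (the centre of the bridge's core `1`), its functionals (`Λ₀of_yLof`, `Λ₁of_yLof`) with the sizes
# **`|Λ₀| ≤ 3m`, `|Λ₁| ≤ 2m`** for displacements `|d₀|, |d₁| ≤ S := n_b + ℓ_b + |h_b|`, `0 ≤ 2mh ≤ ℓ_L + S` (`16S ≤ M_L`); case `o_b = o_L`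
# (`bridgeSame`): `yLs σ := yLof σ n_b h_b ⌊(ℓ_L+ℓ_b)/2⌋`, `qBs := RA′` with **`hxa_s`**, **`hxb_s`**, **`hclr_s`**, `four_qBs_le`, and the case-free
# **`hclr₁_R`**, **`hRn_R`**, **`hB0_R`** (parts RootCasesT: the two transposed cases)

builds on p205010 (kernel theorem, internal audit signed; external expert review pending) — nothing in this file uses p205010; NOTHING is claimed about
the node `SamePDropOfSkeletonNeg₁` (OPEN).
Lane `prim-bschramm-*`, seat `prim-bschramm-stmt` (gen 14); helper file (`--supports stmt-CriticalPhenomena-4575 --as helper`); ledger HOME/prim-bschramm-stmt/NEG-PARAMS.md v0.13.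
[cite: KozmaNitzan2024, §4 p. 28 ((32) at the root), Lemma 10 Step IV] [cite: MartineauTassion2017, §3.2, §4.3]
-/

noncomputable section

open scoped Classical

namespace Summit.CriticalPhenomena.PercolationContinuityZ3.Theorems.Transplant

namespace PlanarSkeletonNeg

namespace NegB

open Literature.Probability.Percolation Literature.Probability.LatticeModels SimpleGraph
open SkelConc (Consts)
open Skelφ (shearUnit shearUnit_pos)
open Skelφ.StepI (DataN)
open ChainPlanar (BridgePrm)
open TwoAxis.Para (modulus)
open Neg

namespace KS

/-! ## §1 The generic run origin and its functionals -/

section Generic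

variable (κ : Consts) {V : Type} [DecidableEq V] [Countable V] {G : SimpleGraph V} [G.LocallyFinite] (Φ : PlanarSkeletonNeg G) (t : V)
  (p : unitInterval) (D : DataN V) (g f : ℕ)

/-- **The run origin** `yLof σ d₀ d₁ mh := (σ·(n_L + d₀), σ·(h_L + d₁) + mh)` (plain coordinates relative to the root). [this work] -/
def yLof (σ d₀ d₁ mh : ℤ) : Site 2 := Skelφ.pt (σ * ((nL κ Φ t p D g f : ℤ) + d₀)) (σ * (hL κ Φ t p D g f + d₁) + mh)

/-- `Λ₀(yLof) = σ·m + σ·(v_β d₀ − v_L d₁) − v_L·mh`. [folklore] -/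
theorem Λ₀of_yLof (σ d₀ d₁ mh : ℤ) : Λ₀of κ Φ t p D g f (yLof κ Φ t p D g f σ d₀ d₁ mh) =
    σ * modulus (nL κ Φ t p D g f) (hL κ Φ t p D g f) (vL κ Φ t p D g f) (Skelφ.NegPrm.vβOf (nL κ Φ t p D g f) (hL κ Φ t p D g f) (ℓL κ Φ t p D g f) (vL κ Φ t p D g f)) +
      σ * (Skelφ.NegPrm.vβOf (nL κ Φ t p D g f) (hL κ Φ t p D g f) (ℓL κ Φ t p D g f) (vL κ Φ t p D g f) * d₀ - vL κ Φ t p D g f * d₁) - vL κ Φ t p D g f * mh := by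
  unfold Λ₀of yLof TwoAxis.Para.modulus; simp only [Skelφ.pt_zero, Skelφ.pt_one]; ring

/-- `Λ₁(yLof) = σ·(n_L d₁ − h_L d₀) + n_L·mh`. [folklore] -/
theorem Λ₁of_yLof (σ d₀ d₁ mh : ℤ) : Λ₁of κ Φ t p D g f (yLof κ Φ t p D g f σ d₀ d₁ mh) =
    σ * ((nL κ Φ t p D g f : ℤ) * d₁ - hL κ Φ t p D g f * d₀) + (nL κ Φ t p D g f : ℤ) * mh := by
  unfold Λ₁of yLof; simp only [Skelφ.pt_zero, Skelφ.pt_one]; ring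

/-- `|yLof|₁ ≤ n_L + |h_L| + |d₀| + |d₁| + |mh|`. [folklore] -/
theorem yLof_l1 {σ : ℤ} (hσ : σ = 1 ∨ σ = -1) (d₀ d₁ mh : ℤ) :
    (yLof κ Φ t p D g f σ d₀ d₁ mh 0).natAbs + (yLof κ Φ t p D g f σ d₀ d₁ mh 1).natAbs ≤
      nL κ Φ t p D g f + (hL κ Φ t p D g f).natAbs + d₀.natAbs + d₁.natAbs + mh.natAbs := by
  have hσ' : |σ| = 1 := by rcases hσ with h | h <;> simp [h]
  have h0 : |yLof κ Φ t p D g f σ d₀ d₁ mh 0| ≤ (nL κ Φ t p D g f : ℤ) + |d₀| := by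
    unfold yLof; rw [Skelφ.pt_zero, abs_mul, hσ', one_mul]
    exact (abs_add_le _ _).trans (by rw [Nat.abs_cast])
  have h1 : |yLof κ Φ t p D g f σ d₀ d₁ mh 1| ≤ |hL κ Φ t p D g f| + |d₁| + |mh| := by
    unfold yLof; rw [Skelφ.pt_one]
    calc |σ * (hL κ Φ t p D g f + d₁) + mh| ≤ |σ * (hL κ Φ t p D g f + d₁)| + |mh| := abs_add_le _ _
      _ ≤ |hL κ Φ t p D g f| + |d₁| + |mh| := by rw [abs_mul, hσ', one_mul]; linarith [abs_add_le (hL κ Φ t p D g f) d₁]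
  have e : (((yLof κ Φ t p D g f σ d₀ d₁ mh 0).natAbs + (yLof κ Φ t p D g f σ d₀ d₁ mh 1).natAbs : ℕ) : ℤ) ≤
      ((nL κ Φ t p D g f + (hL κ Φ t p D g f).natAbs + d₀.natAbs + d₁.natAbs + mh.natAbs : ℕ) : ℤ) := by
    push_cast [Int.natCast_natAbs]; linarith
  exact_mod_cast e

end Generic

/-! ## §2 The functional sizes at the floors -/

section Sizes

variable (κ : Consts) {V : Type} [DecidableEq V] [Countable V] {G : SimpleGraph V} [G.LocallyFinite] (Φ : PlanarSkeletonNeg G) (t : V)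
  (p : unitInterval) (D : DataN V) (mk : ℕ) (gx : Neg.FSlot) (f : ℕ)

/-- **`|Λ₀(yLof)| ≤ 3m` and `|Λ₁(yLof)| ≤ 2m`** at `g := gT` whenever `|d₀|, |d₁| ≤ S := n_b + ℓ_b + |h_b|`, `0 ≤ mh`, `2mh ≤ ℓ_L + S`
(`16S ≤ M_L < n_L, ℓ_L`, `|v_β| ≤ ℓ_L + 10n_L + 1`, `|v_L| ≤ n_L`, `|h_L| ≤ 10n_L`, `m > n_L(ℓ_L − 1) ≥ 8n_L`). [folklore] -/
theorem abs_Λof_yLof_le (hN : EqNumL κ Φ t p D (gT mk gx κ Φ t p D) f) (hκ : (hL κ Φ t p D (gT mk gx κ Φ t p D) f).natAbs ≤ 10 * nL κ Φ t p D (gT mk gx κ Φ t p D) f)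
    {σ : ℤ} (hσ : σ = 1 ∨ σ = -1) {d₀ d₁ mh : ℤ}
    (hd₀ : |d₀| ≤ ((nBR κ Φ t p D mk + ℓBR κ Φ t p D mk + (hBR κ Φ t p D mk).natAbs : ℕ) : ℤ))
    (hd₁ : |d₁| ≤ ((nBR κ Φ t p D mk + ℓBR κ Φ t p D mk + (hBR κ Φ t p D mk).natAbs : ℕ) : ℤ)) (hmh : 0 ≤ mh)
    (hmh' : 2 * mh ≤ (ℓL κ Φ t p D (gT mk gx κ Φ t p D) f : ℤ) + ((nBR κ Φ t p D mk + ℓBR κ Φ t p D mk + (hBR κ Φ t p D mk).natAbs : ℕ) : ℤ)) :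
    |Λ₀of κ Φ t p D (gT mk gx κ Φ t p D) f (yLof κ Φ t p D (gT mk gx κ Φ t p D) f σ d₀ d₁ mh)| ≤
        3 * modulus (nL κ Φ t p D (gT mk gx κ Φ t p D) f) (hL κ Φ t p D (gT mk gx κ Φ t p D) f) (vL κ Φ t p D (gT mk gx κ Φ t p D) f)
          (Skelφ.NegPrm.vβOf (nL κ Φ t p D (gT mk gx κ Φ t p D) f) (hL κ Φ t p D (gT mk gx κ Φ t p D) f) (ℓL κ Φ t p D (gT mk gx κ Φ t p D) f) (vL κ Φ t p D (gT mk gx κ Φ t p D) f)) ∧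
      |Λ₁of κ Φ t p D (gT mk gx κ Φ t p D) f (yLof κ Φ t p D (gT mk gx κ Φ t p D) f σ d₀ d₁ mh)| ≤
        2 * modulus (nL κ Φ t p D (gT mk gx κ Φ t p D) f) (hL κ Φ t p D (gT mk gx κ Φ t p D) f) (vL κ Φ t p D (gT mk gx κ Φ t p D) f)
          (Skelφ.NegPrm.vβOf (nL κ Φ t p D (gT mk gx κ Φ t p D) f) (hL κ Φ t p D (gT mk gx κ Φ t p D) f) (ℓL κ Φ t p D (gT mk gx κ Φ t p D) f) (vL κ Φ t p D (gT mk gx κ Φ t p D) f)) := by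
  obtain ⟨hn1, hℓ1⟩ := one_le_of_eqNumL κ Φ t p D _ f hN
  have hvβ := abs_vβL_le κ Φ t p D _ f hN hκ
  have hv : |vL κ Φ t p D (gT mk gx κ Φ t p D) f| ≤ nL κ Φ t p D (gT mk gx κ Φ t p D) f := hN.v_le
  have hMn := hN.n_le
  have hMℓ := hN.ℓ_le
  have hm := (Skelφ.NegPrm.modulus_vβOf hn1 (hL κ Φ t p D (gT mk gx κ Φ t p D) f) (ℓL κ Φ t p D (gT mk gx κ Φ t p D) f) (vL κ Φ t p D (gT mk gx κ Φ t p D) f)).1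
  have hκ' : |hL κ Φ t p D (gT mk gx κ Φ t p D) f| ≤ 10 * (nL κ Φ t p D (gT mk gx κ Φ t p D) f : ℤ) := by rw [← Int.natCast_natAbs]; exact_mod_cast hκ
  have hS16 : 16 * (((nBR κ Φ t p D mk + ℓBR κ Φ t p D mk + (hBR κ Φ t p D mk).natAbs : ℕ) : ℤ)) ≤ (ML κ Φ t p D (gT mk gx κ Φ t p D) : ℤ) := by
    have := (ML_floorsT κ Φ t p D mk gx).2.2.1
    have h' : ((16 * (nBR κ Φ t p D mk + ℓBR κ Φ t p D mk + (hBR κ Φ t p D mk).natAbs) : ℕ) : ℤ) ≤ (ML κ Φ t p D (gT mk gx κ Φ t p D) : ℤ) := by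
      exact_mod_cast this
    simpa only [Nat.cast_mul, Nat.cast_ofNat] using h'
  have h22 : 22000 * ((RA' κ Φ t p D mk : ℤ) + 2) ≤ (ML κ Φ t p D (gT mk gx κ Φ t p D) : ℤ) := by
    have h' : ((22000 * (RA' κ Φ t p D mk + 2) : ℕ) : ℤ) ≤ (ML κ Φ t p D (gT mk gx κ Φ t p D) : ℤ) := by exact_mod_cast (ML_floorsT κ Φ t p D mk gx).2.1
    push_cast at h'; exact h'
  have hσ' : |σ| = 1 := by rcases hσ with h | h <;> simp [h]
  rw [Λ₀of_yLof, Λ₁of_yLof]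
  have e : vβL κ Φ t p D (gT mk gx κ Φ t p D) f =
      Skelφ.NegPrm.vβOf (nL κ Φ t p D (gT mk gx κ Φ t p D) f) (hL κ Φ t p D (gT mk gx κ Φ t p D) f) (ℓL κ Φ t p D (gT mk gx κ Φ t p D) f) (vL κ Φ t p D (gT mk gx κ Φ t p D) f) := rfl
  rw [← e] at hm ⊢
  generalize modulus (nL κ Φ t p D (gT mk gx κ Φ t p D) f) (hL κ Φ t p D (gT mk gx κ Φ t p D) f) (vL κ Φ t p D (gT mk gx κ Φ t p D) f) (vβL κ Φ t p D (gT mk gx κ Φ t p D) f) = m at hm ⊢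
  generalize ((nBR κ Φ t p D mk + ℓBR κ Φ t p D mk + (hBR κ Φ t p D mk).natAbs : ℕ) : ℤ) = S at hd₀ hd₁ hmh' hS16
  generalize (nL κ Φ t p D (gT mk gx κ Φ t p D) f : ℤ) = n at hn1 hvβ hv hMn hm hκ' ⊢
  generalize (ℓL κ Φ t p D (gT mk gx κ Φ t p D) f : ℤ) = ℓ at hℓ1 hvβ hMℓ hm hmh' ⊢
  generalize (ML κ Φ t p D (gT mk gx κ Φ t p D) : ℤ) = M at hMn hMℓ hS16 h22
  generalize vβL κ Φ t p D (gT mk gx κ Φ t p D) f = vβ at hvβ ⊢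
  generalize vL κ Φ t p D (gT mk gx κ Φ t p D) f = vα at hv ⊢
  generalize hL κ Φ t p D (gT mk gx κ Φ t p D) f = hh at hκ' ⊢
  have hR0 : (0 : ℤ) ≤ (RA' κ Φ t p D mk : ℤ) := by positivity
  have hS0 : 0 ≤ S := le_trans (abs_nonneg _) hd₀
  have hn0 : (0 : ℤ) ≤ n := by linarith
  have hℓ9 : (9 : ℤ) ≤ ℓ := by linarith
  have hm0 : 0 < m := by nlinarith
  -- the products
  have p1 : |vβ * d₀| ≤ (ℓ + 10 * n + 1) * S := by rw [abs_mul]; exact mul_le_mul hvβ hd₀ (abs_nonneg _) (by linarith [abs_nonneg vβ])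
  have p2 : |vα * d₁| ≤ n * S := by rw [abs_mul]; exact mul_le_mul hv hd₁ (abs_nonneg _) hn0
  have p3 : |vα * mh| ≤ n * mh := by rw [abs_mul, abs_of_nonneg hmh]; exact mul_le_mul_of_nonneg_right hv hmh
  have p4 : |n * d₁| ≤ n * S := by rw [abs_mul, abs_of_nonneg hn0]; exact mul_le_mul_of_nonneg_left hd₁ hn0
  have p5 : |hh * d₀| ≤ 10 * n * S := by rw [abs_mul]; exact mul_le_mul hκ' hd₀ (abs_nonneg _) (by positivity)
  -- `16S ≤ n − 1`, `16S ≤ ℓ − 1`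
  have q1 : (ℓ + 1) * (16 * S) ≤ (ℓ + 1) * (n - 1) := mul_le_mul_of_nonneg_left (by linarith) (by linarith)
  have q2 : n * (16 * S) ≤ n * (ℓ - 1) := mul_le_mul_of_nonneg_left (by linarith) hn0
  have q3 : n * (2 * mh) ≤ n * (ℓ + S) := mul_le_mul_of_nonneg_left hmh' hn0
  have q4 : n * 8 ≤ n * (ℓ - 1) := mul_le_mul_of_nonneg_left (by linarith) hn0
  have a1 : |σ * m| = m := by rw [abs_mul, hσ', one_mul, abs_of_pos hm0]
  have a2 : |σ * (vβ * d₀ - vα * d₁)| ≤ (ℓ + 10 * n + 1) * S + n * S := by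
    rw [abs_mul, hσ', one_mul]; exact (abs_sub _ _).trans (add_le_add p1 p2)
  have a3 : |σ * (n * d₁ - hh * d₀)| ≤ n * S + 10 * n * S := by
    rw [abs_mul, hσ', one_mul]; exact (abs_sub _ _).trans (add_le_add p4 p5)
  constructor
  · calc |σ * m + σ * (vβ * d₀ - vα * d₁) - vα * mh| ≤ |σ * m + σ * (vβ * d₀ - vα * d₁)| + |vα * mh| := abs_sub _ _
      _ ≤ |σ * m| + |σ * (vβ * d₀ - vα * d₁)| + |vα * mh| := by linarith [abs_add_le (σ * m) (σ * (vβ * d₀ - vα * d₁))]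
      _ ≤ m + ((ℓ + 10 * n + 1) * S + n * S) + n * mh := by rw [a1]; linarith
      _ ≤ 3 * m := by nlinarith
  · have a4 : |n * mh| = n * mh := by rw [abs_mul, abs_of_nonneg hn0, abs_of_nonneg hmh]
    calc |σ * (n * d₁ - hh * d₀) + n * mh| ≤ |σ * (n * d₁ - hh * d₀)| + |n * mh| := abs_add_le _ _
      _ ≤ (n * S + 10 * n * S) + n * mh := by rw [a4]; linarith
      _ ≤ 2 * m := by nlinarith

end Sizes


/-! ## §3 Case `o_b = o_L` (`bridgeSame`): origin, start half-width, cross link, clearance; the case-free facts -/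

section Same

variable (κ : Consts) {V : Type} [DecidableEq V] [Countable V] {G : SimpleGraph V} [G.LocallyFinite] (Φ : PlanarSkeletonNeg G) (t : V)
  (p : unitInterval) (D : DataN V) (g f mk : ℕ)

/-- The transverse midpoint of the bridge's core `1`, case same: `⌊(ℓ_L + ℓ_b)/2⌋`. [this work] -/
def mhs : ℤ := ((ℓL κ Φ t p D g f : ℤ) + ℓBR κ Φ t p D mk) / 2

/-- **The run origin, case same**: `yLs σ := (σ(n_L + n_b), σ(h_L + h_b) + ⌊(ℓ_L+ℓ_b)/2⌋)` (centre of `bridgeSame`'s core `1`). [this work] -/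
def yLs (σ : ℤ) : Site 2 := yLof κ Φ t p D g f σ (nBR κ Φ t p D mk) (hBR κ Φ t p D mk) (mhs κ Φ t p D g f mk)

/-- **The start half-width, case same**: `qBs := RA′`. [this work] -/
def qBs : ℕ := RA' κ Φ t p D mk

/-- Core `1` of `bridgeSame` in coordinates. [folklore] -/
theorem mem_core1_same_iff (σ : ℤ) (x : Site 2) :
    x ∈ Finset.Icc (Skelφ.bridgeSame σ (nL κ Φ t p D g f) (hL κ Φ t p D g f) (ℓL κ Φ t p D g f) (RA' κ Φ t p D mk) (nBR κ Φ t p D mk) (hBR κ Φ t p D mk) (ℓBR κ Φ t p D mk)).core1Lo (Skelφ.bridgeSame σ (nL κ Φ t p D g f) (hL κ Φ t p D g f) (ℓL κ Φ t p D g f) (RA' κ Φ t p D mk) (nBR κ Φ t p D mk) (hBR κ Φ t p D mk) (ℓBR κ Φ t p D mk)).core1Hi ↔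
      ((nL κ Φ t p D g f : ℤ) - RA' κ Φ t p D mk + nBR κ Φ t p D mk ≤ x 0 ∧ x 0 ≤ (nL κ Φ t p D g f : ℤ) + RA' κ Φ t p D mk + nBR κ Φ t p D mk) ∧
        (σ * hL κ Φ t p D g f - RA' κ Φ t p D mk + σ * hBR κ Φ t p D mk ≤ x 1 ∧ x 1 ≤ σ * hL κ Φ t p D g f + ℓL κ Φ t p D g f + RA' κ Φ t p D mk + (σ * hBR κ Φ t p D mk + ℓBR κ Φ t p D mk)) := by
  have hlo : (Skelφ.bridgeSame σ (nL κ Φ t p D g f) (hL κ Φ t p D g f) (ℓL κ Φ t p D g f) (RA' κ Φ t p D mk) (nBR κ Φ t p D mk) (hBR κ Φ t p D mk) (ℓBR κ Φ t p D mk)).core1Lo = Skelφ.pt ((nL κ Φ t p D g f : ℤ) - RA' κ Φ t p D mk + nBR κ Φ t p D mk) (σ * hL κ Φ t p D g f - RA' κ Φ t p D mk + σ * hBR κ Φ t p D mk) := by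
    funext i; unfold ChainPlanar.BridgePrm.core1Lo Skelφ.bridgeSame
    fin_cases i <;> simp [Skelφ.pt]
  have hhi : (Skelφ.bridgeSame σ (nL κ Φ t p D g f) (hL κ Φ t p D g f) (ℓL κ Φ t p D g f) (RA' κ Φ t p D mk) (nBR κ Φ t p D mk) (hBR κ Φ t p D mk) (ℓBR κ Φ t p D mk)).core1Hi = Skelφ.pt ((nL κ Φ t p D g f : ℤ) + RA' κ Φ t p D mk + nBR κ Φ t p D mk) (σ * hL κ Φ t p D g f + ℓL κ Φ t p D g f + RA' κ Φ t p D mk + (σ * hBR κ Φ t p D mk + ℓBR κ Φ t p D mk)) := by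
    funext i; unfold ChainPlanar.BridgePrm.core1Hi Skelφ.bridgeSame
    fin_cases i <;> simp [Skelφ.pt]
  rw [hlo, hhi, Skelφ.mem_Icc_pt_iff]

/-- **`hxa`, case same**: `|x₀ − σ·yL₀| ≤ qBs` on core `1`. [folklore] -/
theorem hxa_s {σ : ℤ} (hσ : σ = 1 ∨ σ = -1) :
    ∀ x ∈ Finset.Icc (Skelφ.bridgeSame σ (nL κ Φ t p D g f) (hL κ Φ t p D g f) (ℓL κ Φ t p D g f) (RA' κ Φ t p D mk) (nBR κ Φ t p D mk) (hBR κ Φ t p D mk) (ℓBR κ Φ t p D mk)).core1Lo (Skelφ.bridgeSame σ (nL κ Φ t p D g f) (hL κ Φ t p D g f) (ℓL κ Φ t p D g f) (RA' κ Φ t p D mk) (nBR κ Φ t p D mk) (hBR κ Φ t p D mk) (ℓBR κ Φ t p D mk)).core1Hi, |x 0 - σ * yLs κ Φ t p D g f mk σ 0| ≤ (qBs κ Φ t p D mk : ℤ) := by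
  intro x hx
  rw [mem_core1_same_iff] at hx
  have hσsq : σ * σ = 1 := by rcases hσ with h | h <;> simp [h]
  have e : σ * yLs κ Φ t p D g f mk σ 0 = (nL κ Φ t p D g f : ℤ) + nBR κ Φ t p D mk := by
    unfold yLs yLof; rw [Skelφ.pt_zero, ← mul_assoc, hσsq, one_mul]
  rw [e, abs_le]; unfold qBs; constructor <;> linarith [hx.1.1, hx.1.2]

/-- **`hclr`, case same**: `k < σ·yL₀ − qBs − RA′ − n_L = n_b − 2RA′` (`n_b ≥ M_b + bR + 2`, `bR = k + 2RA′ + 1`). [folklore] -/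
theorem hclr_s {σ : ℤ} (hσ : σ = 1 ∨ σ = -1) :
    (D.k : ℤ) < σ * yLs κ Φ t p D g f mk σ 0 - (qBs κ Φ t p D mk : ℤ) - RA' κ Φ t p D mk - nL κ Φ t p D g f := by
  have hσsq : σ * σ = 1 := by rcases hσ with h | h <;> simp [h]
  have e : σ * yLs κ Φ t p D g f mk σ 0 = (nL κ Φ t p D g f : ℤ) + nBR κ Φ t p D mk := by
    unfold yLs yLof; rw [Skelφ.pt_zero, ← mul_assoc, hσsq, one_mul]
  have h1 := (RF2_R κ Φ t p D mk).2.2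
  have h2 := (bR_eq κ Φ t p D mk).1
  have h3 : ((D.k + 2 * RA' κ Φ t p D mk + 3 : ℕ) : ℤ) ≤ (nBR κ Φ t p D mk : ℤ) := by exact_mod_cast (by omega : D.k + 2 * RA' κ Φ t p D mk + 3 ≤ nBR κ Φ t p D mk)
  rw [e]; unfold qBs; push_cast at h3 ⊢; linarith

/-- **`hB0`** (all three cases share the landing box): the hop's landing box IS `B₀`. [folklore] -/
theorem hB0_R (σ : ℤ) :
    Finset.Icc (Skelφ.pt (nL κ Φ t p D g f : ℤ) (σ * hL κ Φ t p D g f)) (Skelφ.pt (nL κ Φ t p D g f : ℤ) (σ * hL κ Φ t p D g f + ℓL κ Φ t p D g f)) ⊆ Finset.Icc (Skelφ.bridgeSame σ (nL κ Φ t p D g f) (hL κ Φ t p D g f) (ℓL κ Φ t p D g f) (RA' κ Φ t p D mk) (nBR κ Φ t p D mk) (hBR κ Φ t p D mk) (ℓBR κ Φ t p D mk)).B₀lo (Skelφ.bridgeSame σ (nL κ Φ t p D g f) (hL κ Φ t p D g f) (ℓL κ Φ t p D g f) (RA' κ Φ t p D mk) (nBR κ Φ t p D mk) (hBR κ Φ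 t p D mk) (ℓBR κ Φ t p D mk)).B₀hi :=
  fun _ h => h

/-- The three frames share `B₀lo`, `B₀hi`, `R′`, `pr`. [folklore] -/
theorem frames_B₀_eq (σ : ℤ) :
    (Skelφ.bridgeTrSide σ (nL κ Φ t p D g f) (hL κ Φ t p D g f) (ℓL κ Φ t p D g f) (RA' κ Φ t p D mk) (nBR κ Φ t p D mk) (hBR κ Φ t p D mk) (ℓBR κ Φ t p D mk)).B₀lo = (Skelφ.bridgeSame σ (nL κ Φ t p D g f) (hL κ Φ t p D g f) (ℓL κ Φ t p D g f) (RA' κ Φ t p D mk) (nBR κ Φ t p D mk) (hBR κ Φ t p D mk) (ℓBR κ Φ t p D mk)).B₀lo ∧ (Skelφ.bridgeTrSide σ (nL κ Φ t p D g f) (hL κ Φ t p D g f) (ℓL κ Φ t p D g f) (RA' κ Φ t p D mk) (nBR κ Φ t p D mk) (hBR κ Φ t p D mk) (ℓBR κ Φ t p D mk)).B₀hi = (Skelφ.bridgeSame σ (nL κ Φ t p D g f) (hL κ Φ t p D g f) (ℓL κ Φ t p D g f) (RA' κ Φ t p D mk) (nBR κ Φ t p D mk) (hBR κ Φ t p D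 mk) (ℓBR κ Φ t p D mk)).B₀hi ∧
      (Skelφ.bridgeTrTop σ (nL κ Φ t p D g f) (hL κ Φ t p D g f) (ℓL κ Φ t p D g f) (RA' κ Φ t p D mk) (nBR κ Φ t p D mk) (hBR κ Φ t p D mk) (ℓBR κ Φ t p D mk)).B₀lo = (Skelφ.bridgeSame σ (nL κ Φ t p D g f) (hL κ Φ t p D g f) (ℓL κ Φ t p D g f) (RA' κ Φ t p D mk) (nBR κ Φ t p D mk) (hBR κ Φ t p D mk) (ℓBR κ Φ t p D mk)).B₀lo ∧ (Skelφ.bridgeTrTop σ (nL κ Φ t p D g f) (hL κ Φ t p D g f) (ℓL κ Φ t p D g f) (RA' κ Φ t p D mk) (nBR κ Φ t p D mk) (hBR κ Φ t p D mk) (ℓBR κ Φ t p D mk)).B₀hi = (Skelφ.bridgeSame σ (nL κ Φ t p D g f) (hL κ Φ t p D g f) (ℓL κ Φ t p D g f) (RA' κ Φ t p D mk) (nBR κ Φ t p D mk) (hBR κ Φ t p D mk) (ℓBR κ Φ t p D mk)).B₀hi ∧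
      (Skelφ.bridgeTrSide σ (nL κ Φ t p D g f) (hL κ Φ t p D g f) (ℓL κ Φ t p D g f) (RA' κ Φ t p D mk) (nBR κ Φ t p D mk) (hBR κ Φ t p D mk) (ℓBR κ Φ t p D mk)).R' = RA' κ Φ t p D mk ∧ (Skelφ.bridgeTrTop σ (nL κ Φ t p D g f) (hL κ Φ t p D g f) (ℓL κ Φ t p D g f) (RA' κ Φ t p D mk) (nBR κ Φ t p D mk) (hBR κ Φ t p D mk) (ℓBR κ Φ t p D mk)).R' = RA' κ Φ t p D mk ∧ (Skelφ.bridgeSame σ (nL κ Φ t p D g f) (hL κ Φ t p D g f) (ℓL κ Φ t p D g f) (RA' κ Φ t p D mk) (nBR κ Φ t p D mk) (hBR κ Φ t p D mk) (ℓBR κ Φ t p D mk)).R' = RA' κ Φ t p D mk ∧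
      (Skelφ.bridgeTrSide σ (nL κ Φ t p D g f) (hL κ Φ t p D g f) (ℓL κ Φ t p D g f) (RA' κ Φ t p D mk) (nBR κ Φ t p D mk) (hBR κ Φ t p D mk) (ℓBR κ Φ t p D mk)).pr = prB κ Φ t p D mk ∧ (Skelφ.bridgeTrTop σ (nL κ Φ t p D g f) (hL κ Φ t p D g f) (ℓL κ Φ t p D g f) (RA' κ Φ t p D mk) (nBR κ Φ t p D mk) (hBR κ Φ t p D mk) (ℓBR κ Φ t p D mk)).pr = prB κ Φ t p D mk ∧ (Skelφ.bridgeSame σ (nL κ Φ t p D g f) (hL κ Φ t p D g f) (ℓL κ Φ t p D g f) (RA' κ Φ t p D mk) (nBR κ Φ t p D mk) (hBR κ Φ t p D mk) (ℓBR κ Φ t p D mk)).pr = prB κ Φ t p D mk :=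
  ⟨rfl, rfl, rfl, rfl, rfl, rfl, rfl, rfl, rfl, rfl⟩

end Same

section SameT

variable (κ : Consts) {V : Type} [DecidableEq V] [Countable V] {G : SimpleGraph V} [G.LocallyFinite] (Φ : PlanarSkeletonNeg G) (t : V)
  (p : unitInterval) (D : DataN V) (mk : ℕ) (gx fx : Neg.FSlot)

/-- `4·qBs ≤ n_L` (`n_L ≥ 2000(RA′+2)`). [folklore] -/
theorem four_qBs_le : 4 * qBs κ Φ t p D mk ≤ nL κ Φ t p D (gT mk gx κ Φ t p D) (fT mk fx κ Φ t p D) := by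
  have := (nL_floorsT κ Φ t p D mk fx (gT mk gx κ Φ t p D)).2.1; unfold qBs; omega

/-- **`hRn`**: `RA′ ≤ n_L`. [folklore] -/
theorem hRn_R : RA' κ Φ t p D mk ≤ nL κ Φ t p D (gT mk gx κ Φ t p D) (fT mk fx κ Φ t p D) := by
  have := (nL_floorsT κ Φ t p D mk fx (gT mk gx κ Φ t p D)).2.1; omega

/-- **`hclr₁`** (case-free): `k < B₀lo 0 − R′ − pr = n_L − RA′ − pr` (`k ≤ M_u < n_b ≤ S`, `16S ≤ M_L`, `22000(RA′+2) ≤ M_L < n_L`, `pr ≤ 3S`). [folklore] -/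
theorem hclr₁_R (hk : D.k ≤ D.M₀) (σ : ℤ) :
    (D.k : ℤ) < (Skelφ.bridgeSame σ (nL κ Φ t p D (gT mk gx κ Φ t p D) (fT mk fx κ Φ t p D)) (hL κ Φ t p D (gT mk gx κ Φ t p D) (fT mk fx κ Φ t p D)) (ℓL κ Φ t p D (gT mk gx κ Φ t p D) (fT mk fx κ Φ t p D)) (RA' κ Φ t p D mk) (nBR κ Φ t p D mk) (hBR κ Φ t p D mk) (ℓBR κ Φ t p D mk)).B₀lo 0 - (Skelφ.bridgeSame σ (nL κ Φ t p D (gT mk gx κ Φ t p D) (fT mk fx κ Φ t p D)) (hL κ Φ t p D (gT mk gx κ Φ t p D) (fT mk fx κ Φ t p D)) (ℓL κ Φ t p D (gT mk gx κ Φ t p D) (fT mk fx κ Φ t p D)) (RA' κ Φ t p D mk) (nBR κ Φ t p D mk) (hBR κ Φ t p D mk) (ℓBR κ Φ t p D mk)).R' - (Skelφ.bridgeSame σ (nL κ Φ t p D (gT mk gx κ Φ t p D) (fT mk fx κ Φ t p D)) (hL κ Φ t p D (gT mk gx κ Φ t p D) (fT mk fx κ Φ t p D)) (ℓL κ Φ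 t p D (gT mk gx κ Φ t p D) (fT mk fx κ Φ t p D)) (RA' κ Φ t p D mk) (nBR κ Φ t p D mk) (hBR κ Φ t p D mk) (ℓBR κ Φ t p D mk)).pr := by
  show (D.k : ℤ) < Skelφ.pt (nL κ Φ t p D (gT mk gx κ Φ t p D) (fT mk fx κ Φ t p D) : ℤ) (σ * hL κ Φ t p D (gT mk gx κ Φ t p D) (fT mk fx κ Φ t p D)) 0 - (RA' κ Φ t p D mk : ℕ) - (prB κ Φ t p D mk : ℕ)
  rw [Skelφ.pt_zero]
  have h1 := five_eR_le_ML κ Φ t p D mk gx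
  have h2 : ML κ Φ t p D (gT mk gx κ Φ t p D) + 1 ≤ nL κ Φ t p D (gT mk gx κ Φ t p D) (fT mk fx κ Φ t p D) := by have := (ML_lt_nL κ Φ t p D (gT mk gx κ Φ t p D) (fT mk fx κ Φ t p D)).1; omega
  have h3 := (ML_floorsT κ Φ t p D mk gx).2.2.1
  have h4 := (RF2_R κ Φ t p D mk).2.1
  have h5 := (MB_floorsR κ Φ t p D mk).2.2
  have h6 := M₀_le_Mu D
  have h7 : D.k + RA' κ Φ t p D mk + prB κ Φ t p D mk < nL κ Φ t p D (gT mk gx κ Φ t p D) (fT mk fx κ Φ t p D) := by unfold eR at h1; omega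
  have h8 : ((D.k + RA' κ Φ t p D mk + prB κ Φ t p D mk : ℕ) : ℤ) < (nL κ Φ t p D (gT mk gx κ Φ t p D) (fT mk fx κ Φ t p D) : ℤ) := by exact_mod_cast h7
  push_cast at h8; linarith

/-- **`hxb`, case same**: the bridge's core `1` lies in the run's start window (`ℓ_b + 22RA′ + 23 ≤ ℓ_L`). [folklore] -/
theorem hxb_s (hN : EqNumL κ Φ t p D (gT mk gx κ Φ t p D) (fT mk fx κ Φ t p D)) (hκ : (hL κ Φ t p D (gT mk gx κ Φ t p D) (fT mk fx κ Φ t p D)).natAbs ≤ 10 * nL κ Φ t p D (gT mk gx κ Φ t p D) (fT mk fx κ Φ t p D)) {σ : ℤ} (hσ : σ = 1 ∨ σ = -1) :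
    ∀ x ∈ Finset.Icc (Skelφ.bridgeSame σ (nL κ Φ t p D (gT mk gx κ Φ t p D) (fT mk fx κ Φ t p D)) (hL κ Φ t p D (gT mk gx κ Φ t p D) (fT mk fx κ Φ t p D)) (ℓL κ Φ t p D (gT mk gx κ Φ t p D) (fT mk fx κ Φ t p D)) (RA' κ Φ t p D mk) (nBR κ Φ t p D mk) (hBR κ Φ t p D mk) (ℓBR κ Φ t p D mk)).core1Lo (Skelφ.bridgeSame σ (nL κ Φ t p D (gT mk gx κ Φ t p D) (fT mk fx κ Φ t p D)) (hL κ Φ t p D (gT mk gx κ Φ t p D) (fT mk fx κ Φ t p D)) (ℓL κ Φ t p D (gT mk gx κ Φ t p D) (fT mk fx κ Φ t p D)) (RA' κ Φ t p D mk) (nBR κ Φ t p D mk) (hBR κ Φ t p D mk) (ℓBR κ Φ t p D mk)).core1Hi,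
      |σ * ((nL κ Φ t p D (gT mk gx κ Φ t p D) (fT mk fx κ Φ t p D) : ℤ) * (x 1 - yLs κ Φ t p D (gT mk gx κ Φ t p D) (fT mk fx κ Φ t p D) mk σ 1) - hL κ Φ t p D (gT mk gx κ Φ t p D) (fT mk fx κ Φ t p D) * (σ * x 0 - yLs κ Φ t p D (gT mk gx κ Φ t p D) (fT mk fx κ Φ t p D) mk σ 0))| + (shearUnit (nL κ Φ t p D (gT mk gx κ Φ t p D) (fT mk fx κ Φ t p D)) (hL κ Φ t p D (gT mk gx κ Φ t p D) (fT mk fx κ Φ t p D)) : ℤ) ≤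
        ((nL κ Φ t p D (gT mk gx κ Φ t p D) (fT mk fx κ Φ t p D) * ℓL κ Φ t p D (gT mk gx κ Φ t p D) (fT mk fx κ Φ t p D) / shearUnit (nL κ Φ t p D (gT mk gx κ Φ t p D) (fT mk fx κ Φ t p D)) (hL κ Φ t p D (gT mk gx κ Φ t p D) (fT mk fx κ Φ t p D)) + 1 : ℕ) : ℤ) * (shearUnit (nL κ Φ t p D (gT mk gx κ Φ t p D) (fT mk fx κ Φ t p D)) (hL κ Φ t p D (gT mk gx κ Φ t p D) (fT mk fx κ Φ t p D)) : ℤ) := by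
  intro x hx
  rw [mem_core1_same_iff] at hx
  obtain ⟨⟨h0l, h0u⟩, ⟨h1l, h1u⟩⟩ := hx
  obtain ⟨hn1, hℓ1⟩ := one_le_of_eqNumL κ Φ t p D _ _ hN
  have hσsq : σ * σ = 1 := by rcases hσ with h | h <;> simp [h]
  have hσabs : |σ| = 1 := by rcases hσ with h | h <;> simp [h]
  have hW := (Wrun_spec κ Φ t p D (gT mk gx κ Φ t p D) (fT mk fx κ Φ t p D) hn1).1
  unfold Wrun at hW
  have hU : (shearUnit (nL κ Φ t p D (gT mk gx κ Φ t p D) (fT mk fx κ Φ t p D)) (hL κ Φ t p D (gT mk gx κ Φ t p D) (fT mk fx κ Φ t p D)) : ℤ) ≤ 11 * (nL κ Φ t p D (gT mk gx κ Φ t p D) (fT mk fx κ Φ t p D) : ℤ) := by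
    have h10 : ((hL κ Φ t p D (gT mk gx κ Φ t p D) (fT mk fx κ Φ t p D)).natAbs : ℤ) ≤ 10 * (nL κ Φ t p D (gT mk gx κ Φ t p D) (fT mk fx κ Φ t p D) : ℤ) := by exact_mod_cast hκ
    unfold Skelφ.shearUnit; simp only [Nat.cast_add]; linarith
  have hκ' : |hL κ Φ t p D (gT mk gx κ Φ t p D) (fT mk fx κ Φ t p D)| ≤ 10 * (nL κ Φ t p D (gT mk gx κ Φ t p D) (fT mk fx κ Φ t p D) : ℤ) := by rw [← Int.natCast_natAbs]; exact_mod_cast hκ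
  -- the floor `ℓ_b + 22RA′ + 23 ≤ ℓ_L`
  have hfl : (ℓBR κ Φ t p D mk : ℤ) + 22 * RA' κ Φ t p D mk + 23 ≤ ℓL κ Φ t p D (gT mk gx κ Φ t p D) (fT mk fx κ Φ t p D) := by
    have h3 := (ML_floorsT κ Φ t p D mk gx).2.2.1
    have h4 := (ML_floorsT κ Φ t p D mk gx).2.1
    have h5 := hN.ℓ_le
    have h6 : ((ℓBR κ Φ t p D mk + 22 * RA' κ Φ t p D mk + 23 : ℕ) : ℤ) ≤ (ML κ Φ t p D (gT mk gx κ Φ t p D) : ℤ) := by exact_mod_cast (by omega : ℓBR κ Φ t p D mk + 22 * RA' κ Φ t p D mk + 23 ≤ ML κ Φ t p D (gT mk gx κ Φ t p D))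
    push_cast at h6; linarith
  -- the origin's coordinates
  have e0 : σ * x 0 - yLs κ Φ t p D (gT mk gx κ Φ t p D) (fT mk fx κ Φ t p D) mk σ 0 = σ * (x 0 - ((nL κ Φ t p D (gT mk gx κ Φ t p D) (fT mk fx κ Φ t p D) : ℤ) + nBR κ Φ t p D mk)) := by
    unfold yLs yLof; rw [Skelφ.pt_zero]; ring
  have e1 : yLs κ Φ t p D (gT mk gx κ Φ t p D) (fT mk fx κ Φ t p D) mk σ 1 = σ * (hL κ Φ t p D (gT mk gx κ Φ t p D) (fT mk fx κ Φ t p D) + hBR κ Φ t p D mk) + mhs κ Φ t p D (gT mk gx κ Φ t p D) (fT mk fx κ Φ t p D) mk := by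
    unfold yLs yLof; rw [Skelφ.pt_one]
  obtain ⟨m1, m2⟩ := RootArith.floor_sandwich (x := (ℓL κ Φ t p D (gT mk gx κ Φ t p D) (fT mk fx κ Φ t p D) : ℤ) + ℓBR κ Φ t p D mk) (d := 2) (by norm_num)
  have em : mhs κ Φ t p D (gT mk gx κ Φ t p D) (fT mk fx κ Φ t p D) mk = ((ℓL κ Φ t p D (gT mk gx κ Φ t p D) (fT mk fx κ Φ t p D) : ℤ) + ℓBR κ Φ t p D mk) / 2 := rfl
  rw [← em] at m1 m2
  set a := x 1 - yLs κ Φ t p D (gT mk gx κ Φ t p D) (fT mk fx κ Φ t p D) mk σ 1 with ha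
  set b := x 0 - ((nL κ Φ t p D (gT mk gx κ Φ t p D) (fT mk fx κ Φ t p D) : ℤ) + nBR κ Φ t p D mk) with hb
  have hb' : |b| ≤ RA' κ Φ t p D mk := abs_le.2 ⟨by rw [hb]; linarith, by rw [hb]; linarith⟩
  have ha' : |2 * a| ≤ (ℓL κ Φ t p D (gT mk gx κ Φ t p D) (fT mk fx κ Φ t p D) : ℤ) + ℓBR κ Φ t p D mk + 2 * RA' κ Φ t p D mk + 1 := by
    rw [ha, e1, abs_le]; constructor <;> linarith
  rw [e0]
  have key : |σ * ((nL κ Φ t p D (gT mk gx κ Φ t p D) (fT mk fx κ Φ t p D) : ℤ) * a - hL κ Φ t p D (gT mk gx κ Φ t p D) (fT mk fx κ Φ t p D) * (σ * b))| ≤ (nL κ Φ t p D (gT mk gx κ Φ t p D) (fT mk fx κ Φ t p D) : ℤ) * |a| + |hL κ Φ t p D (gT mk gx κ Φ t p D) (fT mk fx κ Φ t p D)| * |b| := by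
    rw [abs_mul, hσabs, one_mul]
    calc |(nL κ Φ t p D (gT mk gx κ Φ t p D) (fT mk fx κ Φ t p D) : ℤ) * a - hL κ Φ t p D (gT mk gx κ Φ t p D) (fT mk fx κ Φ t p D) * (σ * b)| ≤ |(nL κ Φ t p D (gT mk gx κ Φ t p D) (fT mk fx κ Φ t p D) : ℤ) * a| + |hL κ Φ t p D (gT mk gx κ Φ t p D) (fT mk fx κ Φ t p D) * (σ * b)| := abs_sub _ _
      _ = (nL κ Φ t p D (gT mk gx κ Φ t p D) (fT mk fx κ Φ t p D) : ℤ) * |a| + |hL κ Φ t p D (gT mk gx κ Φ t p D) (fT mk fx κ Φ t p D)| * |b| := by rw [abs_mul, abs_mul, abs_mul, hσabs, one_mul, Nat.abs_cast]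
  have hn0 : (0 : ℤ) ≤ nL κ Φ t p D (gT mk gx κ Φ t p D) (fT mk fx κ Φ t p D) := by positivity
  have h2a : 2 * ((nL κ Φ t p D (gT mk gx κ Φ t p D) (fT mk fx κ Φ t p D) : ℤ) * |a|) ≤ (nL κ Φ t p D (gT mk gx κ Φ t p D) (fT mk fx κ Φ t p D) : ℤ) * ((ℓL κ Φ t p D (gT mk gx κ Φ t p D) (fT mk fx κ Φ t p D) : ℤ) + ℓBR κ Φ t p D mk + 2 * RA' κ Φ t p D mk + 1) := by
    have : (nL κ Φ t p D (gT mk gx κ Φ t p D) (fT mk fx κ Φ t p D) : ℤ) * |2 * a| ≤ (nL κ Φ t p D (gT mk gx κ Φ t p D) (fT mk fx κ Φ t p D) : ℤ) * ((ℓL κ Φ t p D (gT mk gx κ Φ t p D) (fT mk fx κ Φ t p D) : ℤ) + ℓBR κ Φ t p D mk + 2 * RA' κ Φ t p D mk + 1) := mul_le_mul_of_nonneg_left ha' hn0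
    rw [abs_mul, show |(2:ℤ)| = 2 by norm_num] at this; linarith
  have h2b : |hL κ Φ t p D (gT mk gx κ Φ t p D) (fT mk fx κ Φ t p D)| * |b| ≤ 10 * (nL κ Φ t p D (gT mk gx κ Φ t p D) (fT mk fx κ Φ t p D) : ℤ) * RA' κ Φ t p D mk := mul_le_mul hκ' hb' (abs_nonneg _) (by positivity)
  have hfl' := mul_le_mul_of_nonneg_left hfl hn0
  -- `n_Lℓ_L + 1 ≤ (n_Lℓ_L/U + 1)·U`
  have hUpos : 0 < shearUnit (nL κ Φ t p D (gT mk gx κ Φ t p D) (fT mk fx κ Φ t p D)) (hL κ Φ t p D (gT mk gx κ Φ t p D) (fT mk fx κ Φ t p D)) := by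
    unfold Skelφ.shearUnit; omega
  have hWlo' := Nat.lt_div_mul_add (a := nL κ Φ t p D (gT mk gx κ Φ t p D) (fT mk fx κ Φ t p D) * ℓL κ Φ t p D (gT mk gx κ Φ t p D) (fT mk fx κ Φ t p D)) hUpos
  have hWlo : (nL κ Φ t p D (gT mk gx κ Φ t p D) (fT mk fx κ Φ t p D) : ℤ) * ℓL κ Φ t p D (gT mk gx κ Φ t p D) (fT mk fx κ Φ t p D) + 1 ≤
      ((nL κ Φ t p D (gT mk gx κ Φ t p D) (fT mk fx κ Φ t p D) * ℓL κ Φ t p D (gT mk gx κ Φ t p D) (fT mk fx κ Φ t p D) /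
          shearUnit (nL κ Φ t p D (gT mk gx κ Φ t p D) (fT mk fx κ Φ t p D)) (hL κ Φ t p D (gT mk gx κ Φ t p D) (fT mk fx κ Φ t p D)) + 1 : ℕ) : ℤ) *
        (shearUnit (nL κ Φ t p D (gT mk gx κ Φ t p D) (fT mk fx κ Φ t p D)) (hL κ Φ t p D (gT mk gx κ Φ t p D) (fT mk fx κ Φ t p D)) : ℤ) := by
    have h' : nL κ Φ t p D (gT mk gx κ Φ t p D) (fT mk fx κ Φ t p D) * ℓL κ Φ t p D (gT mk gx κ Φ t p D) (fT mk fx κ Φ t p D) + 1 ≤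
        (nL κ Φ t p D (gT mk gx κ Φ t p D) (fT mk fx κ Φ t p D) * ℓL κ Φ t p D (gT mk gx κ Φ t p D) (fT mk fx κ Φ t p D) /
            shearUnit (nL κ Φ t p D (gT mk gx κ Φ t p D) (fT mk fx κ Φ t p D)) (hL κ Φ t p D (gT mk gx κ Φ t p D) (fT mk fx κ Φ t p D)) + 1) *
          shearUnit (nL κ Φ t p D (gT mk gx κ Φ t p D) (fT mk fx κ Φ t p D)) (hL κ Φ t p D (gT mk gx κ Φ t p D) (fT mk fx κ Φ t p D)) := by
      rw [Nat.add_mul, one_mul]; omega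
    exact_mod_cast h'
  have hab := abs_nonneg (σ * ((nL κ Φ t p D (gT mk gx κ Φ t p D) (fT mk fx κ Φ t p D) : ℤ) * a - hL κ Φ t p D (gT mk gx κ Φ t p D) (fT mk fx κ Φ t p D) * (σ * b)))
  linarith [key, h2a, h2b, hU, hfl', hWlo, abs_nonneg a]

end SameT

end KS

end NegB

end PlanarSkeletonNeg

end Summit.CriticalPhenomena.PercolationContinuityZ3.Theorems.Transplant
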